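import Summits.QuantumFields.YangMills.Theorems.WeakCouplingRatesColdBoxDirichletShiftedMean
import Literature.Probability.Distributions.GaussianWickTheorem

/-!
# Crux `BulkDominatesColdBoxW` (stmt-QuantumFields-19609), interfaces `KernelCovExpansion` / `FlatCovExpansion` of stub L1a: the GAUSSIAN SIDE
# of the one-scale expansion of a kernel COVARIANCE — under the mean-shifted three-colour Dirichlet Gaussian the connected two-point function
# of the quadratic plaquette observables is `(3/2)·C_D(p,q)² + (Σ_c F̄_c(p)F̄_c(q))·C_D(p,q)`, exactly

Companion of `Theorems/WeakCouplingRatesColdBoxDirichletShiftedMean.lean` (means).  With `X_p = dirCirc H p`, `C = C_D(p,q) = boxDirProjKernel H p q`,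
`V_p = C_D(p,p)`, backgrounds `F_c` (at `p`) and `G_c` (at `q`), and the observables `f = ½Σ_c (F_c + X_p(t_c))²`, `g = ½Σ_c (G_c + X_q(t_c))²`
on the three-colour space (`P = boxDirichlet H ^{⊗3}`):

* one colour (Wick, `Literature.Probability.Distributions.GaussianWick`): `integral_dirCirc_mul_dirCirc_sq` (`E[X_pX_q²] = 0`),
  `integral_dirCirc_sq_mul_dirCirc_sq` (`E[X_p²X_q²] = V_pV_q + 2C²`), `integral_const_add_sq_mul_const_add_sq`
  (`E[(F+X_p)²(G+X_q)²] = F²G² + F²V_q + G²V_p + V_pV_q + 4FG·C + 2C²`), `cov_const_add_sq` (`Cov = 4FG·C + 2C²`);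
* three colours: `cov_sum_pi_eq_sum_cov` (independent colour components do not cross-correlate, colour-dependent observables) and
  **`cov_quadObs_pi_eq`** — `E_P[fg] − E_P[f]E_P[g] = (3/2)·C² + (Σ_c F_cG_c)·C` EXACTLY — with the datum form `cov_quadObs_datum_eq`
  (`F_c = sCirc (glue ϑ_c (mean ϑ_c)) p`, observables `½Σ_c (sCirc (glue ϑ_c (mean ϑ_c + t_c)) ·)²`; in `KernelCovExpansion` `ϑ_c ↦ √(2β)ϑ_c`,
  so `Σ_c F_cG_c = 2β·Σ_c F̄_c(p)F̄_c(q)` by `mean_smul`; for `FlatCovExpansion` `ϑ = 0`, `F = G = 0`).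

Fleet seat `ym-spine-20043-p1` (g3, re-targeted to R2ξ by director-ym LINE №76/№78; work split 22:20Z with the line lead `ym-wcr-19609-p1`: Gaussian side
here, YM side there).  No sorry, standard axioms, no new definition, no named-fact hypothesis.  NOT a claim about the mass gap.
-/

set_option autoImplicit false

noncomputable section

open MeasureTheory ProbabilityTheory Finset Matrix Real
open Literature.Probability.LatticeModels
open Literature.MathematicalPhysics.QuantumLattice
open Literature.MathematicalPhysics.QuantumFieldTheory
open Literature.MathematicalPhysics.QuantumFieldTheory.LatticeMaxwell
open Literature.MathematicalPhysics.QuantumFieldTheory.AxialGauge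
open Literature.Probability.Distributions

namespace Summit.QuantumFields.YangMills.Theorems.WeakCouplingRates

/-! ## §1 One colour: mixed moments of two Dirichlet circulations (Wick) -/

section OneColour

variable {H : ℕ}

/-- The two-point function is the projection kernel (definitional repackaging of `integral_dirCirc_mul`). -/
theorem integral_dirCirc_mul_eq_kernel (p q : Plaq 4) :
    ∫ t, dirCirc H p t * dirCirc H q t ∂(boxDirichlet H) = boxDirProjKernel H p q :=
  integral_dirCirc_mul p q

/-- All products of circulations are integrable. -/
theorem integrable_dirCirc_prod {κ : Type*} (s : Finset κ) (r : κ → Plaq 4) :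
    Integrable (fun t => ∏ i ∈ s, dirCirc H (r i) t) (boxDirichlet H) :=
  GaussianWick.integrable_prod (isGaussianProcess_dirCirc H) s r

/-- **Odd moment**: `E_D[X_p · X_q²] = 0`. -/
theorem integral_dirCirc_mul_dirCirc_sq (p q : Plaq 4) :
    ∫ t, dirCirc H p t * dirCirc H q t ^ 2 ∂(boxDirichlet H) = 0 := by
  have h : ∫ t, ∏ i : Fin 3, dirCirc H ((![p, q, q] : Fin 3 → Plaq 4) i) t ∂(boxDirichlet H) = 0 :=
    GaussianWick.integral_prod_odd_eq_zero (isGaussianProcess_dirCirc H) integral_dirCirc 1 ![p, q, q]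
  have hl : ∀ t, ∏ i : Fin 3, dirCirc H ((![p, q, q] : Fin 3 → Plaq 4) i) t = dirCirc H p t * dirCirc H q t ^ 2 := by
    intro t
    simp only [Fin.prod_univ_three, Matrix.cons_val_zero, Matrix.cons_val_one, Matrix.cons_val]
    ring
  simp_rw [hl] at h
  exact h

/-- **Fourth mixed moment (Wick)**: `E_D[X_p² · X_q²] = V_pV_q + 2C²`. -/
theorem integral_dirCirc_sq_mul_dirCirc_sq (p q : Plaq 4) :
    ∫ t, dirCirc H p t ^ 2 * dirCirc H q t ^ 2 ∂(boxDirichlet H) =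
      boxDirProjKernel H p p * boxDirProjKernel H q q + 2 * boxDirProjKernel H p q ^ 2 := by
  have h := GaussianWick.integral_prod_four (isGaussianProcess_dirCirc H) integral_dirCirc ![p, p, q, q]
  simp only [Matrix.cons_val_zero, Matrix.cons_val_one, Matrix.cons_val] at h
  have hl : ∀ t, dirCirc H p t * dirCirc H p t * dirCirc H q t * dirCirc H q t = dirCirc H p t ^ 2 * dirCirc H q t ^ 2 := fun t => by ring
  simp_rw [hl, integral_dirCirc_mul_eq_kernel] at h
  rw [h]
  have hsym : boxDirProjKernel H q p = boxDirProjKernel H p q := by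
    rw [← integral_dirCirc_mul_eq_kernel, ← integral_dirCirc_mul_eq_kernel]
    exact integral_congr_ae (ae_of_all _ fun t => mul_comm _ _)
  ring

/-- **Shifted mixed moment**: `E_D[(F+X_p)²(G+X_q)²] = F²G² + F²V_q + G²V_p + V_pV_q + 4FG·C + 2C²`. -/
theorem integral_const_add_sq_mul_const_add_sq (F G : ℝ) (p q : Plaq 4) :
    ∫ t, (F + dirCirc H p t) ^ 2 * (G + dirCirc H q t) ^ 2 ∂(boxDirichlet H) =
      F ^ 2 * G ^ 2 + F ^ 2 * boxDirProjKernel H q q + G ^ 2 * boxDirProjKernel H p p +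
        boxDirProjKernel H p p * boxDirProjKernel H q q + 4 * F * G * boxDirProjKernel H p q + 2 * boxDirProjKernel H p q ^ 2 := by
  -- the nine monomials
  set Xp := dirCirc H p with hXp
  set Xq := dirCirc H q with hXq
  have i1 : Integrable Xq (boxDirichlet H) := (memLp_two_dirCirc q).integrable one_le_two
  have i2 : Integrable Xp (boxDirichlet H) := (memLp_two_dirCirc p).integrable one_le_two
  have i3 : Integrable (fun t => Xq t ^ 2) (boxDirichlet H) := (memLp_two_dirCirc q).integrable_sq
  have i4 : Integrable (fun t => Xp t ^ 2) (boxDirichlet H) := (memLp_two_dirCirc p).integrable_sq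
  have i5 : Integrable (fun t => Xp t * Xq t) (boxDirichlet H) := (memLp_two_dirCirc p).integrable_mul (memLp_two_dirCirc q)
  have i6 : Integrable (fun t => Xp t * Xq t ^ 2) (boxDirichlet H) := by
    have h := integrable_dirCirc_prod (H := H) Finset.univ ![p, q, q]
    refine h.congr (ae_of_all _ fun t => ?_)
    simp only [Fin.prod_univ_three, Matrix.cons_val_zero, Matrix.cons_val_one, Matrix.cons_val]
    ring
  have i7 : Integrable (fun t => Xp t ^ 2 * Xq t) (boxDirichlet H) := by
    have h := integrable_dirCirc_prod (H := H) Finset.univ ![p, p, q]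
    refine h.congr (ae_of_all _ fun t => ?_)
    simp only [Fin.prod_univ_three, Matrix.cons_val_zero, Matrix.cons_val_one, Matrix.cons_val]
    ring
  have i8 : Integrable (fun t => Xp t ^ 2 * Xq t ^ 2) (boxDirichlet H) := by
    have h := integrable_dirCirc_prod (H := H) Finset.univ ![p, p, q, q]
    refine h.congr (ae_of_all _ fun t => ?_)
    simp only [Fin.prod_univ_four, Matrix.cons_val_zero, Matrix.cons_val_one, Matrix.cons_val]
    ring
  -- values
  have v1 : ∫ t, Xq t ∂(boxDirichlet H) = 0 := integral_dirCirc q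
  have v2 : ∫ t, Xp t ∂(boxDirichlet H) = 0 := integral_dirCirc p
  have v3 : ∫ t, Xq t ^ 2 ∂(boxDirichlet H) = boxDirProjKernel H q q := integral_dirCirc_sq q
  have v4 : ∫ t, Xp t ^ 2 ∂(boxDirichlet H) = boxDirProjKernel H p p := integral_dirCirc_sq p
  have v5 : ∫ t, Xp t * Xq t ∂(boxDirichlet H) = boxDirProjKernel H p q := integral_dirCirc_mul_eq_kernel p q
  have v6 : ∫ t, Xp t * Xq t ^ 2 ∂(boxDirichlet H) = 0 := integral_dirCirc_mul_dirCirc_sq p q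
  have v7 : ∫ t, Xp t ^ 2 * Xq t ∂(boxDirichlet H) = 0 := by
    have h := integral_dirCirc_mul_dirCirc_sq (H := H) q p
    rw [← h]
    exact integral_congr_ae (ae_of_all _ fun t => by simp only [hXp, hXq]; ring)
  have v8 : ∫ t, Xp t ^ 2 * Xq t ^ 2 ∂(boxDirichlet H) =
      boxDirProjKernel H p p * boxDirProjKernel H q q + 2 * boxDirProjKernel H p q ^ 2 := integral_dirCirc_sq_mul_dirCirc_sq p q
  -- expand and integrate term by term (peeling the nine monomials from the right)
  have hexp : ∀ t, (F + Xp t) ^ 2 * (G + Xq t) ^ 2 =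
      F ^ 2 * G ^ 2 + (2 * F ^ 2 * G) * Xq t + F ^ 2 * Xq t ^ 2 + (2 * F * G ^ 2) * Xp t + (4 * F * G) * (Xp t * Xq t) +
        (2 * F) * (Xp t * Xq t ^ 2) + G ^ 2 * Xp t ^ 2 + (2 * G) * (Xp t ^ 2 * Xq t) + Xp t ^ 2 * Xq t ^ 2 := fun t => by ring
  simp_rw [hexp]
  have hS1 : Integrable (fun _ : EuclideanSpace ℝ (DirFree H) => F ^ 2 * G ^ 2) (boxDirichlet H) := integrable_const _
  have hS2 : Integrable (fun t => F ^ 2 * G ^ 2 + (2 * F ^ 2 * G) * Xq t) (boxDirichlet H) := hS1.add (i1.const_mul _)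
  have hS3 : Integrable (fun t => F ^ 2 * G ^ 2 + (2 * F ^ 2 * G) * Xq t + F ^ 2 * Xq t ^ 2) (boxDirichlet H) :=
    hS2.add (i3.const_mul _)
  have hS4 : Integrable (fun t => F ^ 2 * G ^ 2 + (2 * F ^ 2 * G) * Xq t + F ^ 2 * Xq t ^ 2 + (2 * F * G ^ 2) * Xp t)
      (boxDirichlet H) := hS3.add (i2.const_mul _)
  have hS5 : Integrable (fun t => F ^ 2 * G ^ 2 + (2 * F ^ 2 * G) * Xq t + F ^ 2 * Xq t ^ 2 + (2 * F * G ^ 2) * Xp t +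
      (4 * F * G) * (Xp t * Xq t)) (boxDirichlet H) := hS4.add (i5.const_mul _)
  have hS6 : Integrable (fun t => F ^ 2 * G ^ 2 + (2 * F ^ 2 * G) * Xq t + F ^ 2 * Xq t ^ 2 + (2 * F * G ^ 2) * Xp t +
      (4 * F * G) * (Xp t * Xq t) + (2 * F) * (Xp t * Xq t ^ 2)) (boxDirichlet H) := hS5.add (i6.const_mul _)
  have hS7 : Integrable (fun t => F ^ 2 * G ^ 2 + (2 * F ^ 2 * G) * Xq t + F ^ 2 * Xq t ^ 2 + (2 * F * G ^ 2) * Xp t +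
      (4 * F * G) * (Xp t * Xq t) + (2 * F) * (Xp t * Xq t ^ 2) + G ^ 2 * Xp t ^ 2) (boxDirichlet H) := hS6.add (i4.const_mul _)
  have hS8 : Integrable (fun t => F ^ 2 * G ^ 2 + (2 * F ^ 2 * G) * Xq t + F ^ 2 * Xq t ^ 2 + (2 * F * G ^ 2) * Xp t +
      (4 * F * G) * (Xp t * Xq t) + (2 * F) * (Xp t * Xq t ^ 2) + G ^ 2 * Xp t ^ 2 + (2 * G) * (Xp t ^ 2 * Xq t)) (boxDirichlet H) :=
    hS7.add (i7.const_mul _)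
  rw [integral_add hS8 i8, integral_add hS7 (i7.const_mul _), integral_add hS6 (i4.const_mul _), integral_add hS5 (i6.const_mul _),
    integral_add hS4 (i5.const_mul _), integral_add hS3 (i2.const_mul _), integral_add hS2 (i3.const_mul _),
    integral_add hS1 (i1.const_mul _)]
  rw [integral_const, integral_const_mul, integral_const_mul, integral_const_mul, integral_const_mul, integral_const_mul,
    integral_const_mul, integral_const_mul, v1, v2, v3, v4, v5, v6, v7, v8, smul_eq_mul, probReal_univ]
  ring

/-- **Shifted one-colour covariance**: `E_D[(F+X_p)²(G+X_q)²] − E_D[(F+X_p)²]·E_D[(G+X_q)²] = 4FG·C + 2C²`. -/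
theorem cov_const_add_sq (F G : ℝ) (p q : Plaq 4) :
    (∫ t, (F + dirCirc H p t) ^ 2 * (G + dirCirc H q t) ^ 2 ∂(boxDirichlet H)) -
        (∫ t, (F + dirCirc H p t) ^ 2 ∂(boxDirichlet H)) * (∫ t, (G + dirCirc H q t) ^ 2 ∂(boxDirichlet H)) =
      4 * F * G * boxDirProjKernel H p q + 2 * boxDirProjKernel H p q ^ 2 := by
  rw [integral_const_add_sq_mul_const_add_sq, integral_const_add_dirCirc_sq, integral_const_add_dirCirc_sq]
  ring

end OneColour

/-! ## §2 Colour additivity of the connected two-point function (colour-dependent observables) -/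

section Colours

variable {ι Ω : Type*} [Fintype ι] [DecidableEq ι] [MeasurableSpace Ω] (μ : Measure Ω) [IsProbabilityMeasure μ]

/-- **Independent colour components do not cross-correlate** (colour-dependent observables): for `u_c, w_c ∈ L²(μ)`,
`Cov_{μ^{⊗ι}}(Σ_c u_c(x_c), Σ_c w_c(x_c)) = Σ_c Cov_μ(u_c, w_c)`.  (`cov_colourSum_pi` is the case of colour-INDEPENDENT `u`, `w`.) -/
theorem cov_sum_pi_eq_sum_cov (u w : ι → Ω → ℝ) (hu : ∀ c, MemLp (u c) 2 μ) (hw : ∀ c, MemLp (w c) 2 μ) :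
    (∫ x : ι → Ω, (∑ c, u c (x c)) * (∑ c, w c (x c)) ∂(Measure.pi fun _ : ι => μ)) -
        (∫ x : ι → Ω, ∑ c, u c (x c) ∂(Measure.pi fun _ : ι => μ)) *
          (∫ x : ι → Ω, ∑ c, w c (x c) ∂(Measure.pi fun _ : ι => μ)) =
      ∑ c, ((∫ ω, u c ω * w c ω ∂μ) - (∫ ω, u c ω ∂μ) * ∫ ω, w c ω ∂μ) := by
  set Pm := Measure.pi fun _ : ι => μ with hPm
  have hmp : ∀ c : ι, MeasurePreserving (Function.eval c) Pm μ := fun c => MeasureTheory.measurePreserving_eval _ c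
  have hu' : ∀ c, MemLp (fun x : ι → Ω => u c (x c)) 2 Pm := fun c => (hu c).comp_measurePreserving (hmp c)
  have hw' : ∀ c, MemLp (fun x : ι → Ω => w c (x c)) 2 Pm := fun c => (hw c).comp_measurePreserving (hmp c)
  have hiu : ∀ c, Integrable (fun x : ι → Ω => u c (x c)) Pm := fun c => (hu' c).integrable one_le_two
  have hiw : ∀ c, Integrable (fun x : ι → Ω => w c (x c)) Pm := fun c => (hw' c).integrable one_le_two
  have hprod : ∀ c c', Integrable (fun x : ι → Ω => u c (x c) * w c' (x c')) Pm := fun c c' => (hu' c).integrable_mul (hw' c')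
  -- the product of sums
  have h1 : ∫ x, (∑ c, u c (x c)) * (∑ c, w c (x c)) ∂Pm = ∑ c, ∑ c', ∫ x, u c (x c) * w c' (x c') ∂Pm := by
    simp_rw [Finset.sum_mul_sum]
    rw [integral_finsetSum _ fun c _ => integrable_finsetSum _ fun c' _ => hprod c c']
    refine Finset.sum_congr rfl fun c _ => ?_
    rw [integral_finsetSum _ fun c' _ => hprod c c']
  have h2 : ∀ c c', ∫ x, u c (x c) * w c' (x c') ∂Pm =
      (∫ ω, u c ω ∂μ) * (∫ ω, w c' ω ∂μ) + (if c = c' then (∫ ω, u c ω * w c ω ∂μ) - (∫ ω, u c ω ∂μ) * ∫ ω, w c ω ∂μ else 0) := by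
    intro c c'
    by_cases hcc : c = c'
    · subst hcc
      rw [if_pos rfl, hPm, integral_pi_eval_mul_eval_self μ (u c) (w c) c]
      ring
    · rw [if_neg hcc, hPm, integral_pi_eval_mul_eval_of_ne μ (u c) (w c') hcc]
      ring
  have h3 : ∫ x, ∑ c, u c (x c) ∂Pm = ∑ c, ∫ ω, u c ω ∂μ := by
    rw [integral_finsetSum _ fun c _ => hiu c]
    exact Finset.sum_congr rfl fun c _ => integral_pi_eval μ (u c) c
  have h4 : ∫ x, ∑ c, w c (x c) ∂Pm = ∑ c, ∫ ω, w c ω ∂μ := by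
    rw [integral_finsetSum _ fun c _ => hiw c]
    exact Finset.sum_congr rfl fun c _ => integral_pi_eval μ (w c) c
  rw [h1, h3, h4]
  simp_rw [h2, Finset.sum_add_distrib, Finset.sum_ite_eq, Finset.mem_univ, if_true]
  rw [Finset.sum_mul_sum]
  ring

end Colours

/-! ## §3 Three colours: the connected two-point function of the quadratic observables -/

section ThreeColours

variable {H : ℕ}

/-- **Three colours, exact covariance**: with `f = ½Σ_c (F_c + X_p(t_c))²`, `g = ½Σ_c (G_c + X_q(t_c))²` under `D^{⊗3}`,
`E[fg] − E[f]E[g] = (3/2)·C_D(p,q)² + (Σ_c F_cG_c)·C_D(p,q)`. -/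
theorem cov_quadObs_pi_eq (F G : Fin 3 → ℝ) (p q : Plaq 4) :
    (∫ t : Fin 3 → EuclideanSpace ℝ (DirFree H), ((1 / 2 : ℝ) * ∑ c, (F c + dirCirc H p (t c)) ^ 2) *
          ((1 / 2 : ℝ) * ∑ c, (G c + dirCirc H q (t c)) ^ 2) ∂(Measure.pi fun _ : Fin 3 => boxDirichlet H)) -
        (∫ t : Fin 3 → EuclideanSpace ℝ (DirFree H), (1 / 2 : ℝ) * ∑ c, (F c + dirCirc H p (t c)) ^ 2
            ∂(Measure.pi fun _ : Fin 3 => boxDirichlet H)) *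
          (∫ t : Fin 3 → EuclideanSpace ℝ (DirFree H), (1 / 2 : ℝ) * ∑ c, (G c + dirCirc H q (t c)) ^ 2
            ∂(Measure.pi fun _ : Fin 3 => boxDirichlet H)) =
      3 / 2 * boxDirProjKernel H p q ^ 2 + (∑ c, F c * G c) * boxDirProjKernel H p q := by
  set P3 := Measure.pi fun _ : Fin 3 => boxDirichlet H with hP3
  have hu : ∀ c : Fin 3, MemLp (fun s => (F c + dirCirc H p s) ^ 2) 2 (boxDirichlet H) := by
    intro c
    have h4 : MemLp (fun s => F c + dirCirc H p s) 4 (boxDirichlet H) := (memLp_const (F c)).add (memLp_four_dirCirc p)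
    have hi : Integrable (fun s => (F c + dirCirc H p s) ^ 4) (boxDirichlet H) := by
      refine (h4.integrable_norm_pow (by norm_num)).congr (ae_of_all _ fun t => ?_)
      simp only [Real.norm_eq_abs]; exact (show Even 4 by decide).pow_abs _
    have h2 : Integrable (fun s => (F c + dirCirc H p s) ^ 2) (boxDirichlet H) :=
      ((memLp_const (F c)).add (memLp_two_dirCirc p)).integrable_sq
    rw [memLp_two_iff_integrable_sq h2.aestronglyMeasurable]
    exact hi.congr (ae_of_all _ fun t => by simp only; ring)
  have hw : ∀ c : Fin 3, MemLp (fun s => (G c + dirCirc H q s) ^ 2) 2 (boxDirichlet H) := by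
    intro c
    have h4 : MemLp (fun s => G c + dirCirc H q s) 4 (boxDirichlet H) := (memLp_const (G c)).add (memLp_four_dirCirc q)
    have hi : Integrable (fun s => (G c + dirCirc H q s) ^ 4) (boxDirichlet H) := by
      refine (h4.integrable_norm_pow (by norm_num)).congr (ae_of_all _ fun t => ?_)
      simp only [Real.norm_eq_abs]; exact (show Even 4 by decide).pow_abs _
    have h2 : Integrable (fun s => (G c + dirCirc H q s) ^ 2) (boxDirichlet H) :=
      ((memLp_const (G c)).add (memLp_two_dirCirc q)).integrable_sq
    rw [memLp_two_iff_integrable_sq h2.aestronglyMeasurable]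
    exact hi.congr (ae_of_all _ fun t => by simp only; ring)
  have hcov := cov_sum_pi_eq_sum_cov (boxDirichlet H) (fun c s => (F c + dirCirc H p s) ^ 2) (fun c s => (G c + dirCirc H q s) ^ 2) hu hw
  simp only at hcov
  -- pull the factors `½` out
  have hiF : Integrable (fun t : Fin 3 → EuclideanSpace ℝ (DirFree H) => ∑ c, (F c + dirCirc H p (t c)) ^ 2) P3 :=
    integrable_finsetSum _ fun c _ => integrable_comp_eval_pi ((hu c).integrable one_le_two) c
  have hiG : Integrable (fun t : Fin 3 → EuclideanSpace ℝ (DirFree H) => ∑ c, (G c + dirCirc H q (t c)) ^ 2) P3 :=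
    integrable_finsetSum _ fun c _ => integrable_comp_eval_pi ((hw c).integrable one_le_two) c
  have e1 : ∫ t, ((1 / 2 : ℝ) * ∑ c, (F c + dirCirc H p (t c)) ^ 2) * ((1 / 2 : ℝ) * ∑ c, (G c + dirCirc H q (t c)) ^ 2) ∂P3 =
      1 / 4 * ∫ t, (∑ c, (F c + dirCirc H p (t c)) ^ 2) * (∑ c, (G c + dirCirc H q (t c)) ^ 2) ∂P3 := by
    rw [← integral_const_mul]
    exact integral_congr_ae (ae_of_all _ fun t => by ring)
  rw [e1, integral_const_mul, integral_const_mul]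
  have e2 : 1 / 4 * (∫ t, (∑ c, (F c + dirCirc H p (t c)) ^ 2) * (∑ c, (G c + dirCirc H q (t c)) ^ 2) ∂P3) -
      1 / 2 * (∫ t, ∑ c, (F c + dirCirc H p (t c)) ^ 2 ∂P3) * (1 / 2 * ∫ t, ∑ c, (G c + dirCirc H q (t c)) ^ 2 ∂P3) =
      1 / 4 * ((∫ t, (∑ c, (F c + dirCirc H p (t c)) ^ 2) * (∑ c, (G c + dirCirc H q (t c)) ^ 2) ∂P3) -
        (∫ t, ∑ c, (F c + dirCirc H p (t c)) ^ 2 ∂P3) * (∫ t, ∑ c, (G c + dirCirc H q (t c)) ^ 2 ∂P3)) := by ring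
  rw [e2, hP3, hcov]
  simp_rw [cov_const_add_sq]
  rw [Finset.sum_add_distrib, Finset.sum_const, Finset.card_univ, Fintype.card_fin, ← Finset.sum_mul]
  simp only [nsmul_eq_mul, Nat.cast_ofNat]
  have : ∑ c, 4 * F c * G c = 4 * ∑ c, F c * G c := by rw [Finset.mul_sum]; exact Finset.sum_congr rfl fun c _ => by ring
  rw [this]
  ring

/-- **Datum form** (the shape of `KernelCovExpansion` / `FlatCovExpansion`): with one-colour data `ϑ_c`, means `μ_c = mean ϑ_c`, backgrounds
`F̄_c(r) = sCirc (glue ϑ_c μ_c) r` and observables `f_r(t) = ½Σ_c (sCirc (glue ϑ_c (μ_c + t_c)) r)²`: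
`E_{D^{⊗3}}[f_p f_q] − E[f_p]E[f_q] = (3/2)·boxDirProjKernel H p q² + (Σ_c F̄_c(p)F̄_c(q))·boxDirProjKernel H p q`. -/
theorem cov_quadObs_datum_eq (ϑ : Fin 3 → (Literature.MathematicalPhysics.QuantumLattice.ZdEdge 4 → ℝ)) (p q : Plaq 4) :
    (∫ t : Fin 3 → EuclideanSpace ℝ (DirFree H),
        ((1 / 2 : ℝ) * ∑ c, (sCirc (glue (pin := fun e => e ∉ dirFreeEdges H) dirCorner (2 * H + 3) (ϑ c)
            (mean (fun e => e ∉ dirFreeEdges H) dirCorner (2 * H + 3) (ϑ c) + WithLp.ofLp (t c))) p) ^ 2) *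
          ((1 / 2 : ℝ) * ∑ c, (sCirc (glue (pin := fun e => e ∉ dirFreeEdges H) dirCorner (2 * H + 3) (ϑ c)
            (mean (fun e => e ∉ dirFreeEdges H) dirCorner (2 * H + 3) (ϑ c) + WithLp.ofLp (t c))) q) ^ 2)
        ∂(Measure.pi fun _ : Fin 3 => boxDirichlet H)) -
      (∫ t : Fin 3 → EuclideanSpace ℝ (DirFree H),
          (1 / 2 : ℝ) * ∑ c, (sCirc (glue (pin := fun e => e ∉ dirFreeEdges H) dirCorner (2 * H + 3) (ϑ c)
            (mean (fun e => e ∉ dirFreeEdges H) dirCorner (2 * H + 3) (ϑ c) + WithLp.ofLp (t c))) p) ^ 2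
          ∂(Measure.pi fun _ : Fin 3 => boxDirichlet H)) *
        (∫ t : Fin 3 → EuclideanSpace ℝ (DirFree H),
          (1 / 2 : ℝ) * ∑ c, (sCirc (glue (pin := fun e => e ∉ dirFreeEdges H) dirCorner (2 * H + 3) (ϑ c)
            (mean (fun e => e ∉ dirFreeEdges H) dirCorner (2 * H + 3) (ϑ c) + WithLp.ofLp (t c))) q) ^ 2
          ∂(Measure.pi fun _ : Fin 3 => boxDirichlet H)) =
      3 / 2 * boxDirProjKernel H p q ^ 2 +
        (∑ c, (sCirc (glue (pin := fun e => e ∉ dirFreeEdges H) dirCorner (2 * H + 3) (ϑ c)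
              (mean (fun e => e ∉ dirFreeEdges H) dirCorner (2 * H + 3) (ϑ c))) p) *
            (sCirc (glue (pin := fun e => e ∉ dirFreeEdges H) dirCorner (2 * H + 3) (ϑ c)
              (mean (fun e => e ∉ dirFreeEdges H) dirCorner (2 * H + 3) (ϑ c))) q)) *
          boxDirProjKernel H p q := by
  simp_rw [sCirc_glue_add_ofLp]
  exact cov_quadObs_pi_eq _ _ p q

/-- **Flat form** (`FlatCovExpansion`: no datum, no background): `E_{D^{⊗3}}[f_p f_q] − E[f_p]E[f_q] = (3/2)·boxDirProjKernel H p q²` for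
`f_r(t) = ½Σ_c X_r(t_c)²`. -/
theorem cov_quadObs_flat_eq (p q : Plaq 4) :
    (∫ t : Fin 3 → EuclideanSpace ℝ (DirFree H), ((1 / 2 : ℝ) * ∑ c, dirCirc H p (t c) ^ 2) * ((1 / 2 : ℝ) * ∑ c, dirCirc H q (t c) ^ 2)
          ∂(Measure.pi fun _ : Fin 3 => boxDirichlet H)) -
        (∫ t : Fin 3 → EuclideanSpace ℝ (DirFree H), (1 / 2 : ℝ) * ∑ c, dirCirc H p (t c) ^ 2 ∂(Measure.pi fun _ : Fin 3 => boxDirichlet H)) *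
          (∫ t : Fin 3 → EuclideanSpace ℝ (DirFree H), (1 / 2 : ℝ) * ∑ c, dirCirc H q (t c) ^ 2 ∂(Measure.pi fun _ : Fin 3 => boxDirichlet H)) =
      3 / 2 * boxDirProjKernel H p q ^ 2 := by
  have h := cov_quadObs_pi_eq (H := H) (fun _ => 0) (fun _ => 0) p q
  simp only [zero_add, mul_zero, Finset.sum_const_zero, zero_mul, add_zero] at h
  exact h

end ThreeColours

end Summit.QuantumFields.YangMills.Theorems.WeakCouplingRates

end
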